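import Literature.Combinatorics.Optimization.GibbsStateSingleTest
import Literature.Combinatorics.Optimization.PsdRankSeparationAssembly
import HarnessLib

/-!
# Lee–Raghavendra–Steurer 2015, Theorem 3.4 = Theorem 4.1 (density matrix approximation), PROVED

This file DISCHARGES the named fact `LeeRaghavendraSteurer2015_thm34` of
`DensityMatrixApproximation.lean` (LRS Thm 3.4, arXiv:1411.6317 p. 15; = Thm 4.1, p. 18): for a
symmetric `F` with `−τ Id ⪯ F ⪯ τ Id`, a density matrix `Q` and `ε > 0` there is a polynomial `p` of
degree `k ≤ C (1 + S(Q‖𝕀)) τ/ε` with `Tr p(F)² ≠ 0` and `Tr(F p(F)²)/Tr p(F)² ≤ Tr(FQ) + ε`; here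
`C = 110`.  The proof FOLLOWS THE PRINTED ONE (§4.1, p. 18–19):

* Lemma 4.2 (`LeeRaghavendraSteurer2015_lemma42`, `GibbsStateSingleTest.lean`): with
  `λ = 2(S(Q‖𝕀) + 1)/ε`, `Tr(F e^{−λF}/Tr e^{−λF}) ≤ Tr(FQ) + S(Q‖𝕀)/λ ≤ Tr(FQ) + ε/2`;
* Cor 4.4 (`Thm34.exp_taylor_relative`): the truncated exponential series `Σ_{m<n} y^m/m!` has
  RELATIVE error `η` on `[−a, a]` once `n ≥ 9a + log(2/η) + 1` (Mathlib's `Complex.exp_bound'`: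
  remainder `≤ 2|y|ⁿ/n!` for `n + 1 ≥ 2|y|`, and `n! ≥ (n/e)ⁿ` from `Real.pow_div_factorial_le_exp`);
  applied with `a = λτ/2`, `η = ε/(48τ)` to `q(x) = Σ_{m<n} (−λx/2)^m/m!`, a polynomial in `x` of
  degree `< n ≤ 109 (1+S)τ/ε` (using `log x ≤ x` and `τ > ε/2`);
* Lemma 4.3 (`Thm34.weightedAvg_sub_weightedAvg_le`, `Thm34.sq_sub_sq_le_of_rel`): "since `e^F` and
  `p(F)` are simultaneously diagonalizable" both `Tr(F q(F)²)/Tr q(F)²` and `Tr(F e^{−λF})/Tr e^{−λF}`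
  are weighted averages of the eigenvalues `λ_i ∈ [−τ, τ]` of `F` (`Thm34.trace_mul_cfc_eq_sum`,
  `trace_cfc_eq_sum`, `aeval_mul_aeval_eq_cfc`), with weights `q(λ_i)²`, `e^{−λλ_i}` agreeing to
  relative error `3η`; the elementary identity `x/y − x'/y' = (x−x')/y + (y−y')x'/(yy')` bounds the
  difference by `8τ·3η = ε/2`;
* the case `τ ≤ ε/2` (where the degree budget may vanish) is served by `p = 1`:
  `Tr(F)/r ≤ τ ≤ Tr(FQ) + 2τ ≤ Tr(FQ) + ε`;
* `S(Q‖𝕀) ≥ 0` (`S(Q) ≤ log dim`) is the tree's Gibbs variational principle at `β = 0`, transported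
  along `ℝ^{r×r} ⊂ ℂ^{r×r}` (`Lemma42.vonNeumannEntropy_map_ofReal`).

Deviations (bookkeeping only): the paper's `k = 3e(‖F′‖ + log(1/ε′)/log log(1/ε′))` is replaced by the
cruder `n ≤ 9a + log(2/η) + 2` (same shape `O((1+S)τ/ε)`), and the trace-norm statement of Lemma 4.3 by
the weighted-average comparison it is used for.

After this file the LRS main line `Thm 3.1 ⇒ Thm 3.8 ⇒ Thm 1.1 / Cor 1.2` rests on the single external
named fact `FawziEtAl2015_cor68` (John-ellipsoid rescaling of psd factorizations):
`LeeRaghavendraSteurer2015_thm31_of_cor68 : FawziEtAl2015_cor68 → LeeRaghavendraSteurer2015_thm31`.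

Source: [LeeRaghavendraSteurer2015] held text `paper:arxiv-1411.6317`, Thm 3.4 (p. 15), §4.1 (p. 18–19:
Thm 4.1, Lemma 4.2, Lemma 4.3, Cor 4.4, proof of Thm 4.1).  Theorems only (no definitions, no facts).
-/

noncomputable section

open Finset Matrix Polynomial
open scoped MatrixOrder

namespace Literature.Combinatorics.Optimization

namespace Thm34

open Literature.LinearAlgebra.Matrix (cfc_continuousOn trace_cfc_eq_sum_eigenvalues)

/-! ### The truncated exponential series with relative error (Cor 4.4) -/

/-- **Taylor truncation of `eˣ` with RELATIVE error on `[−a, a]`** ("By Taylor's theorem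
`|eˣ − p_k(x)| ≤ eˣ x^{k+1}/(k+1)!` … choose `k` so that … `≤ ε/6`"): for `a ≥ 0` and `0 < η ≤ 1` there is
`n ≤ 9a + log(2/η) + 2` with `|e^y − Σ_{m<n} y^m/m!| ≤ η e^y` for all `|y| ≤ a`.  (From Mathlib's
`Complex.exp_bound'`: the remainder is `≤ 2|y|ⁿ/n!` once `n + 1 ≥ 2|y|`, and `n! ≥ (n/e)ⁿ`.)
[cite: LeeRaghavendraSteurer2015, Cor. 4.4 and its proof (p. 18–19)] -/
theorem exp_taylor_relative {a η : ℝ} (ha : 0 ≤ a) (hη : 0 < η) (hη1 : η ≤ 1) :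
    ∃ n : ℕ, (n : ℝ) ≤ 9 * a + Real.log (2 / η) + 2 ∧
      ∀ y : ℝ, |y| ≤ a →
        |Real.exp y - ∑ m ∈ range n, y ^ m / m.factorial| ≤ η * Real.exp y := by
  have hlog0 : 0 ≤ Real.log (2 / η) := Real.log_nonneg (by rw [le_div_iff₀ hη]; linarith)
  set t : ℝ := 9 * a + Real.log (2 / η) with ht
  have ht0 : 0 ≤ t := by positivity
  refine ⟨⌈t⌉₊ + 1, ?_, ?_⟩
  · have := (Nat.ceil_lt_add_one ht0).le
    push_cast
    linarith
  intro y hy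
  set n : ℕ := ⌈t⌉₊ + 1 with hn
  have hn1 : t + 1 ≤ n := by
    rw [hn]; push_cast; linarith [Nat.le_ceil t]
  have hn0 : (0 : ℝ) < n := by linarith
  -- Mathlib's remainder bound for the complex exponential series
  have hya : ‖(y : ℂ)‖ ≤ a := by rw [Complex.norm_real, Real.norm_eq_abs]; exact hy
  have hcond : ‖(y : ℂ)‖ / (n.succ : ℕ) ≤ 1 / 2 := by
    rw [div_le_iff₀ (by positivity)]
    push_cast
    nlinarith
  have hC := Complex.exp_bound' hcond
  have hreal : ‖Complex.exp (y : ℂ) - ∑ m ∈ range n, (y : ℂ) ^ m / (m.factorial : ℂ)‖ =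
      |Real.exp y - ∑ m ∈ range n, y ^ m / m.factorial| := by
    rw [← Complex.ofReal_exp]
    push_cast
    rw [← Real.norm_eq_abs, ← Complex.norm_real]
    push_cast
    rfl
  rw [hreal] at hC
  -- `2 |y|ⁿ/n! ≤ 2 aⁿ/n! ≤ 2 e^{−n} ≤ η e^{−a} ≤ η e^y`
  have h1 : ‖(y : ℂ)‖ ^ n / n.factorial * 2 ≤ a ^ n / n.factorial * 2 := by
    gcongr
  have hfact : (a : ℝ) ^ n / n.factorial ≤ Real.exp (-(n : ℝ)) := by
    rcases ha.eq_or_lt with h0 | hapos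
    · rw [← h0, zero_pow (by omega), zero_div]; exact (Real.exp_pos _).le
    -- `nⁿ/n! ≤ eⁿ`
    have hst : (n : ℝ) ^ n / n.factorial ≤ Real.exp n := Real.pow_div_factorial_le_exp (x := (n : ℝ)) hn0.le n
    have hnf : (0 : ℝ) < n.factorial := by exact_mod_cast Nat.factorial_pos n
    -- `a e / n ≤ e/9 ≤ e⁻¹`
    have he : Real.exp 1 * Real.exp 1 ≤ 9 := by
      have := Real.exp_one_lt_d9; nlinarith [Real.exp_pos 1]
    have hratio : a * Real.exp 1 / n ≤ Real.exp (-1) := by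
      rw [div_le_iff₀ hn0, Real.exp_neg]
      have h9 : 9 * a ≤ n := by linarith
      have : a * Real.exp 1 * Real.exp 1 ≤ 9 * a := by nlinarith
      calc a * Real.exp 1 = a * Real.exp 1 * Real.exp 1 * (Real.exp 1)⁻¹ := by
            field_simp
        _ ≤ 9 * a * (Real.exp 1)⁻¹ := by gcongr
        _ ≤ (Real.exp 1)⁻¹ * n := by rw [mul_comm]; gcongr
    have hr0 : 0 ≤ a * Real.exp 1 / n := by positivity
    calc a ^ n / n.factorial = a ^ n * ((n : ℝ) ^ n / n.factorial) / (n : ℝ) ^ n := by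
          field_simp
      _ ≤ a ^ n * Real.exp n / (n : ℝ) ^ n := by gcongr
      _ = (a * Real.exp 1 / n) ^ n := by
          rw [div_pow, mul_pow, ← Real.exp_one_pow]
      _ ≤ Real.exp (-1) ^ n := pow_le_pow_left₀ hr0 hratio n
      _ = Real.exp (-(n : ℝ)) := by rw [← Real.exp_nat_mul]; ring_nf
  have h2 : Real.exp (-(n : ℝ)) * 2 ≤ η * Real.exp (-a) := by
    -- `n ≥ a + log(2/η)`
    have hn2 : a + Real.log (2 / η) ≤ n := by linarith
    have : Real.exp (-(n : ℝ)) ≤ Real.exp (-a - Real.log (2 / η)) := Real.exp_le_exp.2 (by linarith)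
    rw [sub_eq_add_neg, Real.exp_add, Real.exp_neg (Real.log _), Real.exp_log (by positivity)] at this
    calc Real.exp (-(n : ℝ)) * 2 ≤ Real.exp (-a) * (2 / η)⁻¹ * 2 := by gcongr
      _ = η * Real.exp (-a) := by field_simp
  have h3 : Real.exp (-a) ≤ Real.exp y := Real.exp_le_exp.2 (by linarith [neg_abs_le y, hy])
  calc |Real.exp y - ∑ m ∈ range n, y ^ m / m.factorial|
      ≤ ‖(y : ℂ)‖ ^ n / n.factorial * 2 := hC
    _ ≤ a ^ n / n.factorial * 2 := h1
    _ ≤ Real.exp (-(n : ℝ)) * 2 := by gcongr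
    _ ≤ η * Real.exp (-a) := h2
    _ ≤ η * Real.exp y := by gcongr

/-! ### Weighted averages of eigenvalues under relative perturbation of the weights (Lemma 4.3) -/

/-- **The comparison step of Lemma 4.3** (eigenvalue-wise, the elementary identity
`x/y − x'/y' = (x−x')/y + (y−y')x'/(yy')`): if `|g_i − h_i| ≤ δ h_i` with `h_i > 0`, `0 ≤ δ ≤ 3/4`,
and `|μ_i| ≤ τ`, then `Σ g > 0` and the `g`- and `h`-weighted averages of `μ` differ by at most `8τδ`.
[cite: LeeRaghavendraSteurer2015, Lemma 4.3 and its proof (p. 18)] -/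
theorem weightedAvg_sub_weightedAvg_le {ι : Type*} [Fintype ι] [Nonempty ι] (μ g h : ι → ℝ)
    {τ δ : ℝ} (hμ : ∀ i, |μ i| ≤ τ) (hh : ∀ i, 0 < h i) (hgh : ∀ i, |g i - h i| ≤ δ * h i)
    (hδ0 : 0 ≤ δ) (hδ : δ ≤ 3 / 4) :
    0 < ∑ i, g i ∧
      |(∑ i, μ i * g i) / (∑ i, g i) - (∑ i, μ i * h i) / (∑ i, h i)| ≤ 8 * τ * δ := by
  have hτ : 0 ≤ τ := (abs_nonneg _).trans (hμ (Classical.arbitrary ι))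
  set H : ℝ := ∑ i, h i with hH
  set G : ℝ := ∑ i, g i with hG
  have hH0 : 0 < H := sum_pos (fun i _ => hh i) univ_nonempty
  have hGH : |G - H| ≤ δ * H := by
    rw [hG, hH, ← sum_sub_distrib, mul_sum]
    exact (abs_sum_le_sum_abs _ _).trans (sum_le_sum fun i _ => hgh i)
  have hG1 : H / 4 ≤ G := by
    have := (abs_le.1 hGH).1
    nlinarith
  have hG0 : 0 < G := by linarith
  refine ⟨hG0, ?_⟩
  -- termwise: `|g_i/G − h_i/H| ≤ 2δ h_i/G`
  have hterm : ∀ i, |g i / G - h i / H| ≤ 2 * δ * h i / G := by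
    intro i
    rw [div_sub_div _ _ hG0.ne' hH0.ne', abs_div, abs_of_pos (mul_pos hG0 hH0)]
    have hnum : |g i * H - G * h i| ≤ 2 * δ * h i * H := by
      have e : g i * H - G * h i = (g i - h i) * H + h i * (H - G) := by ring
      rw [e]
      refine (abs_add_le _ _).trans ?_
      rw [abs_mul, abs_mul, abs_of_pos hH0, abs_of_pos (hh i), abs_sub_comm H G]
      nlinarith [hgh i, hGH, (hh i).le, hH0.le]
    calc |g i * H - G * h i| / (G * H) ≤ 2 * δ * h i * H / (G * H) :=
          div_le_div_of_nonneg_right hnum (by positivity)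
      _ = 2 * δ * h i / G := by field_simp
  have hdiff : (∑ i, μ i * g i) / G - (∑ i, μ i * h i) / H = ∑ i, μ i * (g i / G - h i / H) := by
    rw [sum_div, sum_div, ← sum_sub_distrib]
    exact sum_congr rfl fun i _ => by ring
  rw [hdiff]
  calc |∑ i, μ i * (g i / G - h i / H)| ≤ ∑ i, |μ i * (g i / G - h i / H)| := abs_sum_le_sum_abs _ _
    _ ≤ ∑ i, τ * (2 * δ * h i / G) := sum_le_sum fun i _ => by
        rw [abs_mul]
        exact mul_le_mul (hμ i) (hterm i) (abs_nonneg _) hτ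
    _ = τ * (2 * δ) * (H / G) := by
        rw [← mul_sum]
        have : ∑ i, 2 * δ * h i / G = 2 * δ * H / G := by
          rw [hH, ← sum_div, ← mul_sum]
        rw [this]
        ring
    _ ≤ τ * (2 * δ) * 4 := by
        refine mul_le_mul_of_nonneg_left ?_ (by positivity)
        rw [div_le_iff₀ hG0]; linarith
    _ = 8 * τ * δ := by ring

/-- From a relative approximation of the square root: `|q − s| ≤ η s` (`0 ≤ η ≤ 1`) gives
`|q² − s²| ≤ 3η s²` ("`|eˣ − p(x/2)²| = |e^{x/2} − p(x/2)|·|e^{x/2} + p(x/2)| ≤ … ≤ 3δeˣ`").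
[cite: LeeRaghavendraSteurer2015, Lemma 4.3 proof (p. 18)] -/
theorem sq_sub_sq_le_of_rel {q s η : ℝ} (hs : 0 ≤ s) (hη0 : 0 ≤ η) (hη : η ≤ 1)
    (h : |q - s| ≤ η * s) : |q ^ 2 - s ^ 2| ≤ 3 * η * s ^ 2 := by
  have h1 : |q + s| ≤ (2 + η) * s := by
    have := abs_le.1 h
    rw [abs_le]; constructor <;> nlinarith
  rw [sq_sub_sq, abs_mul, mul_comm]
  calc |q - s| * |q + s| ≤ η * s * ((2 + η) * s) := mul_le_mul h h1 (abs_nonneg _) (by positivity)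
    _ ≤ 3 * η * s ^ 2 := by nlinarith [mul_nonneg hη0 (sq_nonneg s)]

/-! ### Spectral bookkeeping for a symmetric real matrix -/

/-- The eigenvalues of a symmetric `F ⪰ b·Id` are `≥ b`. [cite: LeeRaghavendraSteurer2015, Lemma 4.3 proof (p. 18: "λ₁,…,λₙ ∈ [−τ, τ] denote the eigenvalues of F")] -/
theorem le_eigenvalues_of_smul_one_le {R : ℕ} {Q : Matrix (Fin R) (Fin R) ℝ} (hQ : Q.IsHermitian)
    {b : ℝ} (hle : b • (1 : Matrix (Fin R) (Fin R) ℝ) ≤ Q) (i : Fin R) : b ≤ hQ.eigenvalues i := by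
  obtain ⟨U, hU⟩ : ∃ U : Matrix (Fin R) (Fin R) ℝ,
      U = (hQ.eigenvectorUnitary : Matrix (Fin R) (Fin R) ℝ) := ⟨_, rfl⟩
  have hUm : U ∈ Matrix.unitaryGroup (Fin R) ℝ := hU ▸ hQ.eigenvectorUnitary.2
  have hUU : star U * U = 1 := Matrix.mem_unitaryGroup_iff'.1 hUm
  have hspec : Q = U * diagonal (RCLike.ofReal ∘ hQ.eigenvalues) * star U := by
    rw [hU]
    conv_lhs => rw [hQ.spectral_theorem, Unitary.conjStarAlgAut_apply]
  have hdiag : star U * Q * U = diagonal (RCLike.ofReal ∘ hQ.eigenvalues) := by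
    calc star U * Q * U = star U * (U * diagonal (RCLike.ofReal ∘ hQ.eigenvalues) * star U) * U := by
          conv_lhs => arg 1; arg 2; rw [hspec]
      _ = diagonal (RCLike.ofReal ∘ hQ.eigenvalues) := by
          simp only [Matrix.mul_assoc]
          rw [← Matrix.mul_assoc (star U) U, hUU, Matrix.one_mul, Matrix.mul_one]
  rw [Matrix.le_iff] at hle
  have hpsd := hle.conjTranspose_mul_mul_same U
  rw [← star_eq_conjTranspose, Matrix.mul_sub, Matrix.sub_mul, Matrix.mul_smul, Matrix.mul_one,
    Matrix.smul_mul, hUU, hdiag] at hpsd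
  have h := hpsd.diag_nonneg (i := i)
  simp only [Matrix.sub_apply, Matrix.smul_apply, Matrix.one_apply_eq, diagonal_apply_eq,
    smul_eq_mul, mul_one, Function.comp_apply, RCLike.ofReal_real_eq_id, id_eq] at h
  linarith

/-- `Tr(F · f(F)) = Σ λ_k f(λ_k)` and `Tr f(F) = Σ f(λ_k)` for symmetric `F`. [cite: LeeRaghavendraSteurer2015, Lemma 4.3 proof (p. 18: "Since e^F and p(F) are simultaneously diagonalizable")] -/
theorem trace_mul_cfc_eq_sum {R : ℕ} {F : Matrix (Fin R) (Fin R) ℝ} (hF : F.IsHermitian) (f : ℝ → ℝ) :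
    (F * cfc f F).trace = ∑ k, hF.eigenvalues k * f (hF.eigenvalues k) := by
  have hF' : IsSelfAdjoint F := hF
  have hmul : F * cfc f F = cfc (fun x => x * f x) F := by
    rw [cfc_mul (fun x : ℝ => x) f F (cfc_continuousOn F _) (cfc_continuousOn F _), cfc_id' ℝ F]
  rw [hmul, trace_cfc_eq_sum_eigenvalues hF]
  rfl

/-- `Tr f(F) = Σ f(λ_k)`. [cite: LeeRaghavendraSteurer2015, Lemma 4.3 proof (p. 18)] -/
theorem trace_cfc_eq_sum {R : ℕ} {F : Matrix (Fin R) (Fin R) ℝ} (hF : F.IsHermitian) (f : ℝ → ℝ) :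
    (cfc f F).trace = ∑ k, f (hF.eigenvalues k) := by
  rw [trace_cfc_eq_sum_eigenvalues hF]
  rfl

/-- `p(F)² = (p²)(F)` through the functional calculus. [cite: LeeRaghavendraSteurer2015, Thm 4.1 (p. 18: "p(F)²")] -/
theorem aeval_mul_aeval_eq_cfc {R : ℕ} {F : Matrix (Fin R) (Fin R) ℝ} (hF : F.IsHermitian) (p : ℝ[X]) :
    aeval F p * aeval F p = cfc (fun x => p.eval x * p.eval x) F := by
  have hF' : IsSelfAdjoint F := hF
  rw [← cfc_polynomial p F, ← cfc_mul _ _ F (cfc_continuousOn F _) (cfc_continuousOn F _)]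


/-- `Tr(A B) ≥ 0` for real psd `A, B` (`Tr(A B) = Tr(A^{1/2} B A^{1/2})`). [cite: LeeRaghavendraSteurer2015, §2.1 (p. 10: "Recall Tr(AᵀB) ≤ ‖A‖·‖B‖_*")] -/
theorem trace_mul_nonneg_of_posSemidef' {r : ℕ} {A B : Matrix (Fin r) (Fin r) ℝ}
    (hA : A.PosSemidef) (hB : B.PosSemidef) : 0 ≤ (A * B).trace := by
  set S : Matrix (Fin r) (Fin r) ℝ := CFC.sqrt A with hS
  have hSpsd : S.PosSemidef := (CFC.sqrt_nonneg A).posSemidef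
  have hSS : S * S = A := CFC.sqrt_mul_sqrt_self A
  have hSH : Sᴴ = S := hSpsd.1
  have hM : (S * B * Sᴴ).PosSemidef := hB.mul_mul_conjTranspose_same S
  have htrM : (S * B * Sᴴ).trace = (A * B).trace := by
    rw [hSH, Matrix.mul_assoc, trace_mul_comm, Matrix.mul_assoc, hSS, trace_mul_comm]
  rw [← htrM]
  exact hM.trace_nonneg


open Complex (ofRealHom) in
open Thm34 Lemma42 in
/-- **Lee–Raghavendra–Steurer 2015, Theorem 3.4 = Theorem 4.1 (density matrix approximation), PROVED:**
the named fact `LeeRaghavendraSteurer2015_thm34` holds, with the universal constant `C = 110`.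
Proof = the printed one (p. 18–19): Lemma 4.2 with `λ = 2(S(Q‖𝕀)+1)/ε` (`LeeRaghavendraSteurer2015_lemma42`),
then the truncated exponential series `q(x) = Σ_{m<n} (−λx/2)^m/m!` (Cor 4.4, `Thm34.exp_taylor_relative`
with relative error `η = ε/(48τ)` on `[−λτ/2, λτ/2]`) compared eigenvalue-wise with `e^{−λF}`
(Lemma 4.3, `Thm34.weightedAvg_sub_weightedAvg_le`); the case `τ ≤ ε/2` is served by the constant
polynomial `p = 1` (`Tr(F𝕀) ≤ τ ≤ Tr(FQ) + 2τ`).  `S(Q‖𝕀) ≥ 0` is imported from the tree's Gibbs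
variational principle at `β = 0` through the complexification of `GibbsStateSingleTest.lean`.
[cite: LeeRaghavendraSteurer2015, Thm. 3.4 (p. 15) = Thm. 4.1 and its proof (p. 18–19)] -/
theorem _root_.Literature.Combinatorics.Optimization.LeeRaghavendraSteurer2015_thm34_holds :
    LeeRaghavendraSteurer2015_thm34 := by
  refine ⟨110, by norm_num, ?_⟩
  intro r F Q hF hQ τ hFge hFle ε hε
  have hr : 0 < r := by
    rcases Nat.eq_zero_or_pos r with h | h
    · exfalso
      subst h
      have := hQ.2
      rw [Matrix.trace_fin_zero] at this
      exact zero_ne_one this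
    · exact h
  have hr' : (0 : ℝ) < r := by exact_mod_cast hr
  haveI : Nonempty (Fin r) := ⟨⟨0, hr⟩⟩
  have hFh : F.IsHermitian := isHermitian_of_isSymm hF
  have hQsymm : Q.IsSymm := by
    have h := hQ.1.1.eq
    rwa [conjTranspose_eq_transpose_of_trivial] at h
  -- the eigenvalues of `F` lie in `[−τ, τ]`
  have hμle : ∀ i, hFh.eigenvalues i ≤ τ := Thm31.eigenvalues_le_of_le_smul_one hFh hFle
  have hμge : ∀ i, -τ ≤ hFh.eigenvalues i := fun i =>
    le_eigenvalues_of_smul_one_le hFh (by rw [neg_smul]; exact hFge) i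
  have hμ : ∀ i, |hFh.eigenvalues i| ≤ τ := fun i => abs_le.2 ⟨hμge i, hμle i⟩
  have hτ0 : 0 ≤ τ := (abs_nonneg _).trans (hμ ⟨0, hr⟩)
  -- `S(Q‖𝕀) ≥ 0`
  obtain ⟨S, hS_def⟩ : ∃ S : ℝ, S = relEntropy Q (uniformDensity r) := ⟨_, rfl⟩
  rw [← hS_def]
  have hS0 : 0 ≤ S := by
    have hQc := posSemidef_map_ofReal hQ.1
    have hQc1 : (Q.map ofRealHom).trace = 1 := by rw [trace_map_ofReal, hQ.2, Complex.ofReal_one]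
    have h0 : (0 : Matrix (Fin r) (Fin r) ℂ).IsHermitian := Matrix.isHermitian_zero
    have hv := h0.vonNeumannEntropy_sub_mul_le_log_partitionFn 0 hQc hQc1
    have hZ : Matrix.partitionFn 0 (0 : Matrix (Fin r) (Fin r) ℂ) = r := by
      simp [Matrix.partitionFn, Matrix.gibbsWeight, NormedSpace.exp_zero, Matrix.trace_one,
        Fintype.card_fin]
    rw [hZ, zero_mul, sub_zero, Complex.natCast_re] at hv
    rw [hS_def, relEntropy_uniformDensity hr hQ.2, ← vonNeumannEntropy_map_ofReal hQsymm]
    linarith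
  by_cases hA : τ ≤ ε / 2
  · -- small `‖F‖`: the constant polynomial `p = 1`, `k = 0`
    refine ⟨0, 1, ?_, by simp, ?_, ?_⟩
    · push_cast
      exact div_nonneg (mul_nonneg (mul_nonneg (by norm_num) (by linarith)) hτ0) hε.le
    · rw [map_one, Matrix.mul_one, Matrix.trace_one, Fintype.card_fin]
      exact hr'.ne'
    · rw [map_one, Matrix.mul_one, Matrix.mul_one, Matrix.trace_one, Fintype.card_fin]
      have h1 : F.trace ≤ τ * r := by
        have := Thm33.trace_mono hFle
        rwa [trace_smul, Matrix.trace_one, Fintype.card_fin, smul_eq_mul] at this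
      have h2 : -τ ≤ (F * Q).trace := by
        have hpsd : (F - (-(τ • (1 : Matrix (Fin r) (Fin r) ℝ)))).PosSemidef := by
          rw [← Matrix.le_iff]; exact hFge
        have h := trace_mul_nonneg_of_posSemidef' hpsd hQ.1
        rw [sub_neg_eq_add, Matrix.add_mul, Matrix.smul_mul, Matrix.one_mul, trace_add, trace_smul,
          hQ.2, smul_eq_mul, mul_one] at h
        linarith
      calc F.trace / r ≤ τ := by rw [div_le_iff₀ hr']; linarith
        _ ≤ (F * Q).trace + ε := by linarith
  -- large `‖F‖`: `τ > ε/2`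
  have hτε : ε / 2 < τ := not_le.1 hA
  have hτpos : 0 < τ := by linarith
  obtain ⟨lam, hlam⟩ : ∃ l : ℝ, l = 2 * (S + 1) / ε := ⟨_, rfl⟩
  have hlam0 : 0 < lam := by rw [hlam]; exact div_pos (by linarith) hε
  obtain ⟨a, ha_def⟩ : ∃ a : ℝ, a = lam * τ / 2 := ⟨_, rfl⟩
  have ha0 : 0 ≤ a := by rw [ha_def]; positivity
  obtain ⟨η, hη_def⟩ : ∃ η : ℝ, η = ε / (48 * τ) := ⟨_, rfl⟩
  have hη0 : 0 < η := by rw [hη_def]; positivity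
  have hη1 : η ≤ 1 := by
    rw [hη_def, div_le_one (by positivity)]; linarith
  have h3η : 3 * η ≤ 3 / 4 := by
    rw [hη_def]
    have : ε / (48 * τ) ≤ 1 / 4 := by
      rw [div_le_div_iff₀ (by positivity) (by norm_num)]; linarith
    linarith
  obtain ⟨n, hn, hT⟩ := exp_taylor_relative ha0 hη0 hη1
  -- the polynomial `q(x) = Σ_{m<n} (−λx/2)^m / m!`
  obtain ⟨P, hP⟩ : ∃ P : ℝ[X], P = ∑ m ∈ range n, Polynomial.C ((m.factorial : ℝ)⁻¹) * X ^ m :=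
    ⟨_, rfl⟩
  obtain ⟨q, hq⟩ : ∃ q : ℝ[X], q = P.comp (Polynomial.C (-(lam / 2)) * X) := ⟨_, rfl⟩
  have hqeval : ∀ x, q.eval x = ∑ m ∈ range n, (-(lam / 2) * x) ^ m / m.factorial := by
    intro x
    rw [hq, eval_comp, eval_mul, eval_C, eval_X, hP, eval_finsetSum]
    refine sum_congr rfl fun m _ => ?_
    rw [eval_mul, eval_C, eval_pow, eval_X]
    ring
  have hqdeg : q.natDegree ≤ n := by
    rw [hq]
    refine natDegree_comp_le.trans ?_
    have h1 : P.natDegree ≤ n := by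
      rw [hP]
      refine natDegree_sum_le_of_forall_le _ _ fun m hm => ?_
      exact (natDegree_C_mul_X_pow_le _ _).trans (mem_range.1 hm).le
    have h2 : (Polynomial.C (-(lam / 2)) * X : ℝ[X]).natDegree ≤ 1 :=
      (natDegree_C_mul_le _ _).trans natDegree_X_le
    calc P.natDegree * (Polynomial.C (-(lam / 2)) * X : ℝ[X]).natDegree ≤ n * 1 :=
          Nat.mul_le_mul h1 h2
      _ = n := mul_one n
  refine ⟨n, q, ?_, hqdeg, ?_⟩
  · -- the degree bound `n ≤ 9a + log(2/η) + 2 ≤ 110 (1 + S) τ/ε`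
    obtain ⟨u, hu⟩ : ∃ u : ℝ, u = (S + 1) * τ / ε := ⟨_, rfl⟩
    have hu1 : a = u := by rw [ha_def, hlam, hu]; field_simp
    have hτu : τ / ε ≤ u := by
      rw [hu]
      refine div_le_div_of_nonneg_right ?_ hε.le
      nlinarith
    have hu0 : 1 / 2 ≤ τ / ε := by rw [le_div_iff₀ hε]; linarith
    have h2 : Real.log (2 / η) ≤ 96 * u := by
      have he : 2 / η = 96 * (τ / ε) := by rw [hη_def]; field_simp; ring
      rw [he]
      have hx : 0 < 96 * (τ / ε) := by positivity
      linarith [Real.log_le_sub_one_of_pos hx]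
    calc (n : ℝ) ≤ 9 * a + Real.log (2 / η) + 2 := hn
      _ ≤ 9 * u + 96 * u + 4 * u := by rw [hu1]; linarith
      _ = 109 * ((1 + S) * τ / ε) := by rw [hu]; ring
      _ ≤ 110 * ((1 + S) * τ / ε) := by
          have : 0 ≤ (1 + S) * τ / ε := by positivity
          linarith
      _ = 110 * (1 + S) * τ / ε := by ring
  -- eigenvalue-wise comparison of `q(F)²` with `e^{−λF}`
  have hqi : ∀ i, |q.eval (hFh.eigenvalues i) - Real.exp (-(lam / 2) * hFh.eigenvalues i)| ≤
      η * Real.exp (-(lam / 2) * hFh.eigenvalues i) := by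
    intro i
    rw [hqeval]
    have hy : |-(lam / 2) * hFh.eigenvalues i| ≤ a := by
      rw [abs_mul, abs_neg, abs_of_pos (by positivity : 0 < lam / 2), ha_def]
      calc lam / 2 * |hFh.eigenvalues i| ≤ lam / 2 * τ :=
            mul_le_mul_of_nonneg_left (hμ i) (by positivity)
        _ = lam * τ / 2 := by ring
    have := hT (-(lam / 2) * hFh.eigenvalues i) hy
    rw [abs_sub_comm] at this
    exact this
  have hgh : ∀ i, |q.eval (hFh.eigenvalues i) * q.eval (hFh.eigenvalues i) -
      Real.exp (-(lam * hFh.eigenvalues i))| ≤ 3 * η * Real.exp (-(lam * hFh.eigenvalues i)) := by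
    intro i
    have hs : Real.exp (-(lam * hFh.eigenvalues i)) = Real.exp (-(lam / 2) * hFh.eigenvalues i) ^ 2 := by
      rw [← Real.exp_nat_mul]; ring_nf
    rw [hs, ← pow_two]
    exact sq_sub_sq_le_of_rel (Real.exp_pos _).le hη0.le hη1 (hqi i)
  obtain ⟨hGpos, hdiff⟩ := weightedAvg_sub_weightedAvg_le hFh.eigenvalues
    (fun i => q.eval (hFh.eigenvalues i) * q.eval (hFh.eigenvalues i))
    (fun i => Real.exp (-(lam * hFh.eigenvalues i))) hμ (fun i => Real.exp_pos _) hgh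
    (by positivity) h3η
  -- traces as eigenvalue sums
  have ht1 : (aeval F q * aeval F q).trace = ∑ i, q.eval (hFh.eigenvalues i) * q.eval (hFh.eigenvalues i) := by
    rw [aeval_mul_aeval_eq_cfc hFh, trace_cfc_eq_sum hFh]
  have ht2 : (F * (aeval F q * aeval F q)).trace =
      ∑ i, hFh.eigenvalues i * (q.eval (hFh.eigenvalues i) * q.eval (hFh.eigenvalues i)) := by
    rw [aeval_mul_aeval_eq_cfc hFh, trace_mul_cfc_eq_sum hFh]
  obtain ⟨W, hW⟩ : ∃ W : Matrix (Fin r) (Fin r) ℝ, W = cfc (fun x => Real.exp (-(lam * x))) F :=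
    ⟨_, rfl⟩
  have ht3 : W.trace = ∑ i, Real.exp (-(lam * hFh.eigenvalues i)) := by
    rw [hW, trace_cfc_eq_sum hFh]
  have ht4 : (F * W).trace = ∑ i, hFh.eigenvalues i * Real.exp (-(lam * hFh.eigenvalues i)) := by
    rw [hW, trace_mul_cfc_eq_sum hFh]
  -- Lemma 4.2 for `λ`
  have h42 := LeeRaghavendraSteurer2015_lemma42 hF hQ hlam0
  rw [← hW, ← hS_def, Matrix.mul_smul, trace_smul, smul_eq_mul] at h42
  have hSl : S / lam ≤ ε / 2 := by
    have he : ε / 2 * lam = S + 1 := by rw [hlam]; field_simp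
    rw [div_le_iff₀ hlam0, he]
    linarith
  have h24 : 8 * τ * (3 * η) = ε / 2 := by rw [hη_def]; field_simp; ring
  refine ⟨?_, ?_⟩
  · rw [ht1]; exact hGpos.ne'
  · rw [ht2, ht1]
    have hB : (∑ i, hFh.eigenvalues i * Real.exp (-(lam * hFh.eigenvalues i))) /
        (∑ i, Real.exp (-(lam * hFh.eigenvalues i))) ≤ (F * Q).trace + ε / 2 := by
      rw [← ht3, ← ht4, div_eq_inv_mul]
      linarith
    have := (abs_le.1 hdiff).2
    linarith


end Thm34

/-- **LRS Theorem 3.1 from John's-position rescaling alone:** with Thm 3.4 proved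
(`LeeRaghavendraSteurer2015_thm34_holds`) and the assembly `LeeRaghavendraSteurer2015_thm31_of_cor68_thm34`,
the separation theorem `LeeRaghavendraSteurer2015_thm31` — hence Thm 3.8, Thm 1.1 and Cor 1.2 through
the tree's `_of_thm31`/`_of_thm38` theorems — follows from the single named fact `FawziEtAl2015_cor68`.
[cite: LeeRaghavendraSteurer2015, Thm. 3.1 (p. 14), proof p. 14–19] -/
theorem LeeRaghavendraSteurer2015_thm31_of_cor68 (h68 : FawziEtAl2015_cor68) :
    LeeRaghavendraSteurer2015_thm31 :=
  LeeRaghavendraSteurer2015_thm31_of_cor68_thm34 h68 LeeRaghavendraSteurer2015_thm34_holds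

/-- **LRS Theorem 3.8 (= the engine fact `LeeRaghavendraSteurer2015_thm38` of the psd-rank ladder) from
`FawziEtAl2015_cor68` alone.** [cite: LeeRaghavendraSteurer2015, Thm. 3.8 (p. 17)] -/
theorem LeeRaghavendraSteurer2015_thm38_of_cor68 (h68 : FawziEtAl2015_cor68) :
    LeeRaghavendraSteurer2015_thm38 :=
  LeeRaghavendraSteurer2015_thm38_of_thm31 (LeeRaghavendraSteurer2015_thm31_of_cor68 h68)

end Literature.Combinatorics.Optimization

end
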